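import Literature.MathematicalPhysics.QuantumFieldTheory.Balaban1983to89.Beta.WilsonVertexKron

/-!
# THE PHYSICAL (SYMMETRISED) FIRST-ORDER WILSON HESSIAN IS (ANTISYMMETRIC COLOUR MATRIX) ⊗ (THE ANTISYMMETRISED COLOURLESS TABLE);
# its colour-blind bubble carries `trace (A·A′)` exactly

HONEST FRAMING (cell `pub-balaban`, β sub-cell, lineage an3; verbatim): discharging `BetaPertH` makes Bałaban's UV stability
UNCONDITIONAL — a real constructive-QFT result; it is NOT the continuum limit and NOT the Clay problem.  This file discharges NOTHING
of `BetaPertH`.  It is the companion of `Beta.WilsonVertexKron` (the one-bond Wilson vertex is `A ⊗ W₀`): `wilsonVertex₁ e z γ A` is a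
matrix OF the quadratic form `v ↦ v·V·v` (headline `PlaquetteStencil.actionJet21_eq_wilsonVertex₁`), NOT a symmetric matrix; the
Hessian proper is its symmetric part.  For the colour matrices that occur (`A = adM τ t Y`, ANTISYMMETRIC, `PlaquetteVertex.adM_antisymm`)
the symmetric part of `A ⊗ W₀` is `A ⊗ ½(W₀ − W₀ᵀ)`: THE SYMMETRIC PART OF THE COLOURLESS TABLE DROPS OUT OF THE FORM, AND THE PHYSICAL
COLOURLESS TABLE IS THE ANTISYMMETRISED ONE — the reading `wilsonA = ½(wEntry x z α β − wEntry z x β α)` that an2's `Beta.StepJetData`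
(v1.1) takes.  This file says so in the kernel and redoes the colour-blind contractions of `WilsonVertexKron` for the symmetrised vertex.

ABSOLUTE RULE (cell charter, verbatim in substance): no internally-minted statement enters as a cited fact; every hypothesis of every
theorem below is kernel-proved in this package; NOTHING is cited.

WHAT IS KERNEL-CHECKED.
* §1 SYMMETRISATION ALGEBRA: `symPart M := 2⁻¹ • (M + Mᵀ)`; `symPart_transpose`, `symPart_of_symm`; **`dotProduct_symPart_mulVec : v ⬝ᵥ symPart M *ᵥ v =
  v ⬝ᵥ M *ᵥ v`** (the form does not see the antisymmetric part); **`trace_mul_symPart : Kᵀ = K → trace (K · symPart M) = trace (K · M)`**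
  (a SYMMETRIC kernel does not see it either; `trace_mul_transpose_of_symm`); transposes of the building blocks: `kron_transpose`
  (`(A ⊗ N)ᵀ = Aᵀ ⊗ Nᵀ`, Mathlib's `kroneckerMap_transpose`), `neg_kron`, `stencilIns_smul`, `stencilIns_neg`, **`stencilIns_transpose : (stencilIns z S α β m)ᵀ = stencilIns z S β α
  (fun s ↦ (m s)ᵀ)`**, **`stencilIns_sum_elim`** (a stencil over `σ ⊕ σ′` is the sum of the two), **`mconvKernel_transpose :
  (mconvKernel g)ᵀ = mconvKernel (fun z ↦ (g (−z))ᵀ)`** (so a leg is symmetric iff `g (−z) = (g z)ᵀ`, `mconvKernel_transpose_of_refl`),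
  `cbLeg_transpose`.
* §2 THE ANTISYMMETRISED COLOURLESS WILSON STENCIL: data `wnA γ : WilsonIdx D ⊕ WilsonIdx D → Matrix D D ℝ := Sum.elim (2⁻¹ • wn γ)
  (−2⁻¹ • (wn γ ·)ᵀ)`, offsets `wαA := Sum.elim wα wβ`, `wβA := Sum.elim wβ wα`, **`wilsonStencilA e z γ := stencilIns z univ (wαA e γ) (wβA e γ)
  (wnA γ)`**; **`wilsonStencilA_eq : wilsonStencilA e z γ = 2⁻¹ • (wilsonStencil₀ e z γ − (wilsonStencil₀ e z γ)ᵀ)`**; ENTRYWISE IN an2's READING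
  **`wilsonStencilA_apply_eq_unit : wilsonStencilA e z γ (x,α) (y,β) = 2⁻¹ * (wilsonVertex₁ (C := Unit) e z γ 1 (x,((),α)) (y,((),β)) −
  wilsonVertex₁ (C := Unit) e z γ 1 (y,((),β)) (x,((),α)))`** — LITERALLY the formula of `StepJetData.wilsonA` (there on `ℤ^{d+1}`, `e := unitVec`).
* §3 THE SYMMETRISED VERTEX AT AN ANTISYMMETRIC COLOUR MATRIX (`Aᵀ = −A`): `wilsonVertex₁_transpose`; **`symPart_wilsonVertex₁ :
  symPart (wilsonVertex₁ e z γ A) = stencilIns z univ (wαA e γ) (wβA e γ) (fun s ↦ A ⊗ₖ wnA γ s)`**; ENTRYWISE **`symPart_wilsonVertex₁_apply :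
  symPart (wilsonVertex₁ e z γ A) (x,(a,α)) (y,(b,β)) = A a b · wilsonStencilA e z γ (x,α) (y,β)`**; `adM_transpose : (adM τ t Y)ᵀ = −adM τ t Y`;
  and the HEADLINE FORM READ ON THE SYMMETRISED VERTEX **`actionJet21_eq_symPart : −½·actionJet21(field t v; e_z ⊗ e_γ ⊗ Y) =
  ½ · v ⬝ᵥ symPart (wilsonVertex₁ e z γ (adM τ t Y)) *ᵥ v`**.
* §4 COLOUR-BLIND CONTRACTIONS OF THE SYMMETRISED VERTEX (antisymmetric `A`, `A′`; ANY legs `mconvKernel (cbLeg G)`, no symmetry of the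
  legs needed): **`wilsonBubbleSym_colourBlind : trace (Kcb G · symPart V(z,γ;A) · (Kcb G′ · symPart V(z+w,γ′;A′))) = trace (A·A′) ·
  trace (mconvKernel G · wilsonStencilA e z γ · (mconvKernel G′ · wilsonStencilA e (z+w) γ′))`** (+ `_table` over `(WilsonIdx D ⊕ WilsonIdx D)²`,
  base-point independence `wilsonBubbleA_translate`, Bałaban letters **`wilsonBubbleSym_gen`**: weight `[c = c′]·(−2N²)` by
  `ColourTrace.trace_adMat_gen` BY NAME); **`wilsonTadpoleSym_colourBlind`** `= trace A · (…)`, hence **`wilsonTadpoleSym_eq_zero`** (antisymmetric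
  `A` is traceless, `WilsonVertexKron.trace_eq_zero_of_antisymm`).

READING FOR THE CELL.  an2 (consumer): your ERRATUM F-an2g8-1 («the physical (V-Δ) field block is the ANTISYMMETRISED table `wilsonA`»)
is, for the Wilson first-order vertex, a theorem on an3's side: `symPart (A ⊗ W₀) = A ⊗ W_A` with `W_A` = your `wilsonA` formula
(`wilsonStencilA_apply_eq_unit`, `symPart_wilsonVertex₁_apply`), and the F2 factorisation holds for the physical Hessians with the SAME single
weight `trace (A·A′)` (`wilsonBubbleSym_colourBlind`).  Cross-readers (pv19-g7 XREAD of `PlaquetteVertex2Stencil` v1, INFO I2): at first order the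
«symmetrise before contracting against a non-symmetric kernel» caveat is discharged here in closed form; the second-order (`hess22`) analogue is
NOT in this file.

NOT PROVED, NOT CLAIMED: anything about an2's packed fibre, multiplier blocks, `KInv`, localisation or rates; the second-order symmetrisation;
any propagator / bubble / β-coefficient VALUE (NO comparison with `11N/3`); gauge fixing/averaging; `BetaPertH`, UV stability, continuum limit,
Clay.  Identity-level bookkeeping; no numerics.
-/

namespace Literature.MathematicalPhysics.QuantumFieldTheory.Balaban1983to89.Beta.WilsonVertexSym

open Finset
open scoped BigOperators Matrix Kronecker
open Literature.MathematicalPhysics.QuantumFieldTheory.Balaban1983to89.Beta.BubbleTable (stencilIns mconvKernel mconvKernel_apply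
  bubble_stencil_eq_table_m contact_stencil_m)
open Literature.MathematicalPhysics.QuantumFieldTheory.Balaban1983to89.Beta.PlaquetteStencil (wilsonVertex₁ actionJet21_eq_wilsonVertex₁)
open Literature.MathematicalPhysics.QuantumFieldTheory.Balaban1983to89.Beta.PlaquetteStencilData (WilsonIdx wα wβ stencilIns_apply)
open Literature.MathematicalPhysics.QuantumFieldTheory.Balaban1983to89.Beta.PlaquetteVertex2Stencil (cbLeg)
open Literature.MathematicalPhysics.QuantumFieldTheory.Balaban1983to89.Beta.ColourTrace (Complete TrOrthonormal adMat trace_adMat_gen)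
open Literature.MathematicalPhysics.QuantumFieldTheory.Balaban1983to89.Beta.PlaquetteVertex (jet21 field bondLetter rntr gen adM adM_antisymm
  adM_gen)
open Literature.MathematicalPhysics.QuantumFieldTheory.Balaban1983to89.Beta.WilsonVertexKron (wn wilsonStencil₀ wilsonVertex₁_eq_kronStencil
  wilsonStencil₀_apply_eq_unit cbLeg_eq_kronecker trace_kronLeg_mul trace_kronLeg_mul_kronLeg_mul trace_eq_zero_of_antisymm kron_neg)

/-! ## §1 Symmetrisation algebra and transposes of the building blocks -/

section Sym

variable {ι : Type*}

/-- THE SYMMETRIC PART `symPart M := 2⁻¹ • (M + Mᵀ)`.  A definition asserting nothing. [folklore] -/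
noncomputable def symPart (M : Matrix ι ι ℝ) : Matrix ι ι ℝ := (2 : ℝ)⁻¹ • (M + Mᵀ)

/-- `symPart M` is symmetric. [folklore] -/
theorem symPart_transpose (M : Matrix ι ι ℝ) : (symPart M)ᵀ = symPart M := by
  rw [symPart, Matrix.transpose_smul, Matrix.transpose_add, Matrix.transpose_transpose, add_comm]

/-- a symmetric matrix is its own symmetric part. [folklore] -/
theorem symPart_of_symm {M : Matrix ι ι ℝ} (hM : Mᵀ = M) : symPart M = M := by
  rw [symPart, hM, ← two_smul ℝ M, smul_smul, inv_mul_cancel₀ (two_ne_zero' ℝ), one_smul]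

variable [Fintype ι]

/-- **THE FORM DOES NOT SEE THE ANTISYMMETRIC PART**: `v ⬝ᵥ symPart M *ᵥ v = v ⬝ᵥ M *ᵥ v` (the transpose step `v ⬝ᵥ Mᵀ *ᵥ v = v ⬝ᵥ M *ᵥ v`
is Mathlib's `mulVec_transpose` + `dotProduct_mulVec` + `dotProduct_comm`, inlined). [folklore] -/
theorem dotProduct_symPart_mulVec (M : Matrix ι ι ℝ) (v : ι → ℝ) : v ⬝ᵥ (symPart M *ᵥ v) = v ⬝ᵥ (M *ᵥ v) := by
  rw [symPart, Matrix.smul_mulVec, dotProduct_smul, Matrix.add_mulVec, dotProduct_add, Matrix.mulVec_transpose, Matrix.dotProduct_mulVec,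
    dotProduct_comm v (v ᵥ* M), ← two_smul ℝ (v ᵥ* M ⬝ᵥ v), smul_smul, inv_mul_cancel₀ (two_ne_zero' ℝ), one_smul]

/-- a SYMMETRIC kernel does not see the transpose: `Kᵀ = K → trace (K · Mᵀ) = trace (K · M)`. [folklore] -/
theorem trace_mul_transpose_of_symm {K : Matrix ι ι ℝ} (hK : Kᵀ = K) (M : Matrix ι ι ℝ) :
    Matrix.trace (K * Mᵀ) = Matrix.trace (K * M) := by
  rw [← Matrix.trace_transpose (K * Mᵀ), Matrix.transpose_mul, Matrix.transpose_transpose, hK, Matrix.trace_mul_comm]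

/-- **A SYMMETRIC KERNEL DOES NOT SEE THE ANTISYMMETRIC PART**: `Kᵀ = K → trace (K · symPart M) = trace (K · M)`. [folklore] -/
theorem trace_mul_symPart {K : Matrix ι ι ℝ} (hK : Kᵀ = K) (M : Matrix ι ι ℝ) :
    Matrix.trace (K * symPart M) = Matrix.trace (K * M) := by
  rw [symPart, Matrix.mul_smul, Matrix.trace_smul, Matrix.mul_add, Matrix.trace_add, trace_mul_transpose_of_symm hK,
    ← two_smul ℝ (Matrix.trace (K * M)), smul_smul, inv_mul_cancel₀ (two_ne_zero' ℝ), one_smul]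

end Sym

section Transposes

variable {C : Type*} {D : Type*}

/-- `(A ⊗ₖ N)ᵀ = Aᵀ ⊗ₖ Nᵀ` (Mathlib's `Matrix.kroneckerMap_transpose`). [folklore] -/
theorem kron_transpose (A : Matrix C C ℝ) (N : Matrix D D ℝ) : (A ⊗ₖ N)ᵀ = Aᵀ ⊗ₖ Nᵀ :=
  Matrix.kroneckerMap_transpose _ A N

/-- `(−A) ⊗ₖ N = −(A ⊗ₖ N)`. [folklore] -/
theorem neg_kron (A : Matrix C C ℝ) (N : Matrix D D ℝ) : (-A) ⊗ₖ N = -(A ⊗ₖ N) := by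
  ext ⟨a, k⟩ ⟨b, k'⟩
  simp only [Matrix.kronecker_apply, Matrix.neg_apply, neg_mul]

variable {Λ : Type*} [DecidableEq Λ] [AddCommGroup Λ] {X : Type*} {σ : Type*}

/-- **TRANSPOSE OF A STENCIL** = the stencil with row/column offsets swapped and blocks transposed. [folklore] -/
theorem stencilIns_transpose (z : Λ) (S : Finset σ) (α β : σ → Λ) (m : σ → Matrix X X ℝ) :
    (stencilIns z S α β m)ᵀ = stencilIns z S β α (fun s => (m s)ᵀ) := by
  ext p q
  rw [Matrix.transpose_apply, stencilIns_apply, stencilIns_apply]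
  refine Finset.sum_congr rfl fun s _ => ?_
  simp only [Matrix.transpose_apply, and_comm]

/-- scalars pull out of a stencil's blocks. [folklore] -/
theorem stencilIns_smul (z : Λ) (S : Finset σ) (α β : σ → Λ) (r : ℝ) (m : σ → Matrix X X ℝ) :
    stencilIns z S α β (fun s => r • m s) = r • stencilIns z S α β m := by
  ext p q
  rw [Matrix.smul_apply, stencilIns_apply, stencilIns_apply, smul_eq_mul, Finset.mul_sum]
  refine Finset.sum_congr rfl fun s _ => ?_
  rw [Matrix.smul_apply, smul_eq_mul, mul_ite, mul_zero]

/-- signs pull out of a stencil's blocks. [folklore] -/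
theorem stencilIns_neg (z : Λ) (S : Finset σ) (α β : σ → Λ) (m : σ → Matrix X X ℝ) :
    stencilIns z S α β (fun s => -m s) = -stencilIns z S α β m := by
  ext p q
  rw [Matrix.neg_apply, stencilIns_apply, stencilIns_apply, ← Finset.sum_neg_distrib]
  refine Finset.sum_congr rfl fun s _ => ?_
  split_ifs
  · rw [Matrix.neg_apply]
  · rw [neg_zero]

/-- **A STENCIL OVER `σ ⊕ σ′` IS THE SUM OF THE TWO STENCILS**. [folklore] -/
theorem stencilIns_sum_elim {σ' : Type*} [Fintype σ] [Fintype σ'] (z : Λ) (α β : σ → Λ) (m : σ → Matrix X X ℝ) (α' β' : σ' → Λ)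
    (m' : σ' → Matrix X X ℝ) :
    stencilIns z univ (Sum.elim α α') (Sum.elim β β') (Sum.elim m m') = stencilIns z univ α β m + stencilIns z univ α' β' m' := by
  ext p q
  simp only [Matrix.add_apply, stencilIns_apply, Fintype.sum_sum_type, Sum.elim_inl, Sum.elim_inr]

omit [DecidableEq Λ] in
/-- **TRANSPOSE OF A TRANSLATION-INVARIANT LEG**: `(mconvKernel g)ᵀ = mconvKernel (fun z ↦ (g (−z))ᵀ)`. [folklore] -/
theorem mconvKernel_transpose (g : Λ → Matrix X X ℝ) : (mconvKernel g)ᵀ = mconvKernel fun z => (g (-z))ᵀ := by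
  ext ⟨u, a⟩ ⟨v, b⟩
  simp only [Matrix.transpose_apply, mconvKernel_apply, neg_sub]

omit [DecidableEq Λ] in
/-- a reflection-symmetric leg table (`g (−z) = (g z)ᵀ`, the shape of a covariance) gives a SYMMETRIC kernel. [folklore] -/
theorem mconvKernel_transpose_of_refl {g : Λ → Matrix X X ℝ} (hg : ∀ z, g (-z) = (g z)ᵀ) : (mconvKernel g)ᵀ = mconvKernel g := by
  rw [mconvKernel_transpose]
  congr 1
  funext z
  rw [hg, Matrix.transpose_transpose]

omit [DecidableEq Λ] [AddCommGroup Λ] in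
/-- transpose of the colour-blind leg: `(cbLeg G z)ᵀ = cbLeg (fun z ↦ (G z)ᵀ) z`. [folklore] -/
theorem cbLeg_transpose [DecidableEq C] (G : Λ → Matrix D D ℝ) (z : Λ) : (cbLeg (C := C) G z)ᵀ = cbLeg (C := C) (fun z => (G z)ᵀ) z := by
  rw [cbLeg_eq_kronecker, cbLeg_eq_kronecker, kron_transpose, Matrix.transpose_one]

end Transposes

/-! ## §2 The antisymmetrised colourless Wilson stencil (an2's `wilsonA` reading) -/

section StencilA

variable {Λ : Type*} [DecidableEq Λ] [AddCommGroup Λ] {C : Type*} {D : Type*} [Fintype D] [DecidableEq D]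

/-- colourless block data of the ANTISYMMETRISED stencil: `½·wn γ s` on the direct copy, `−½·(wn γ s)ᵀ` on the transposed copy.
A definition asserting nothing. [folklore] -/
noncomputable def wnA (γ : D) : WilsonIdx D ⊕ WilsonIdx D → Matrix D D ℝ :=
  Sum.elim (fun s => (2 : ℝ)⁻¹ • wn γ s) (fun s => (2 : ℝ)⁻¹ • (-(wn γ s)ᵀ))

/-- row offsets of the antisymmetrised stencil: `wα` on the direct copy, `wβ` on the transposed copy. [folklore] -/
def wαA (e : D → Λ) (γ : D) : WilsonIdx D ⊕ WilsonIdx D → Λ := Sum.elim (wα e γ) (wβ e γ)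

/-- column offsets of the antisymmetrised stencil: `wβ` on the direct copy, `wα` on the transposed copy. [folklore] -/
def wβA (e : D → Λ) (γ : D) : WilsonIdx D ⊕ WilsonIdx D → Λ := Sum.elim (wβ e γ) (wα e γ)

/-- **THE ANTISYMMETRISED COLOURLESS WILSON STENCIL** of the background bond `(z, γ)` on `Λ × D`.  A definition asserting nothing.
[folklore] -/
noncomputable def wilsonStencilA (e : D → Λ) (z : Λ) (γ : D) : Matrix (Λ × D) (Λ × D) ℝ :=
  stencilIns z univ (wαA e γ) (wβA e γ) (wnA γ)

/-- **`wilsonStencilA = ½(W₀ − W₀ᵀ)`**. [folklore] -/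
theorem wilsonStencilA_eq (e : D → Λ) (z : Λ) (γ : D) :
    wilsonStencilA e z γ = (2 : ℝ)⁻¹ • (wilsonStencil₀ e z γ - (wilsonStencil₀ e z γ)ᵀ) := by
  rw [wilsonStencilA, wαA, wβA, wnA, stencilIns_sum_elim, stencilIns_smul, stencilIns_smul, stencilIns_neg, wilsonStencil₀,
    stencilIns_transpose, smul_sub, sub_eq_add_neg, smul_neg]

/-- **an2's READING**: entrywise, `wilsonStencilA e z γ (x,α) (y,β) = ½ (wEntry x y α β − wEntry y x β α)` with `wEntry` the `C := Unit, A := 1`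
reading of `wilsonVertex₁` — literally the formula of `StepJetData.wilsonA`. [folklore] -/
theorem wilsonStencilA_apply_eq_unit (e : D → Λ) (z : Λ) (γ : D) (x y : Λ) (α β : D) :
    wilsonStencilA e z γ (x, α) (y, β) =
      (2 : ℝ)⁻¹ * (wilsonVertex₁ (C := Unit) e z γ (1 : Matrix Unit Unit ℝ) (x, ((), α)) (y, ((), β)) -
        wilsonVertex₁ (C := Unit) e z γ (1 : Matrix Unit Unit ℝ) (y, ((), β)) (x, ((), α))) := by
  rw [wilsonStencilA_eq, Matrix.smul_apply, Matrix.sub_apply, Matrix.transpose_apply, wilsonStencil₀_apply_eq_unit,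
    wilsonStencil₀_apply_eq_unit, smul_eq_mul]

/-- `wilsonStencilA` is antisymmetric. [folklore] -/
theorem wilsonStencilA_transpose (e : D → Λ) (z : Λ) (γ : D) : (wilsonStencilA e z γ)ᵀ = -wilsonStencilA e z γ := by
  rw [wilsonStencilA_eq, Matrix.transpose_smul, Matrix.transpose_sub, Matrix.transpose_transpose, ← smul_neg, neg_sub]

end StencilA

/-! ## §3 The symmetrised vertex at an antisymmetric colour matrix -/

section SymVertex

variable {Λ : Type*} [DecidableEq Λ] [AddCommGroup Λ] {C : Type*} {D : Type*} [Fintype D] [DecidableEq D]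

/-- transpose of the Wilson vertex: offsets swapped, blocks `Aᵀ ⊗ (wn γ s)ᵀ`. [folklore] -/
theorem wilsonVertex₁_transpose (e : D → Λ) (z : Λ) (γ : D) (A : Matrix C C ℝ) :
    (wilsonVertex₁ e z γ A)ᵀ = stencilIns z univ (wβ e γ) (wα e γ) (fun s => Aᵀ ⊗ₖ (wn γ s)ᵀ) := by
  rw [wilsonVertex₁_eq_kronStencil, stencilIns_transpose]
  simp only [kron_transpose]

/-- **THE SYMMETRISED WILSON VERTEX AT AN ANTISYMMETRIC COLOUR MATRIX IS THE KRONECKER STENCIL OF THE ANTISYMMETRISED DATA**: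
`Aᵀ = −A → symPart (wilsonVertex₁ e z γ A) = stencilIns z univ (wαA e γ) (wβA e γ) (fun s ↦ A ⊗ₖ wnA γ s)`. [folklore] -/
theorem symPart_wilsonVertex₁ (e : D → Λ) (z : Λ) (γ : D) {A : Matrix C C ℝ} (hA : Aᵀ = -A) :
    symPart (wilsonVertex₁ e z γ A) = stencilIns z univ (wαA e γ) (wβA e γ) (fun s => A ⊗ₖ wnA γ s) := by
  have h1 : (fun s : WilsonIdx D ⊕ WilsonIdx D => A ⊗ₖ wnA γ s) =
      Sum.elim (fun s => (2 : ℝ)⁻¹ • (A ⊗ₖ wn γ s)) (fun s => (2 : ℝ)⁻¹ • (Aᵀ ⊗ₖ (wn γ s)ᵀ)) := by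
    funext s
    rcases s with s | s
    · simp only [wnA, Sum.elim_inl, Matrix.kronecker_smul]
    · simp only [wnA, Sum.elim_inr, Matrix.kronecker_smul, kron_neg, hA, neg_kron]
  rw [h1, wαA, wβA, stencilIns_sum_elim, stencilIns_smul, stencilIns_smul, ← wilsonVertex₁_eq_kronStencil, ← wilsonVertex₁_transpose,
    symPart, smul_add]

/-- **ENTRYWISE: `symPart (wilsonVertex₁ e z γ A) (x,(a,α)) (y,(b,β)) = A a b · wilsonStencilA e z γ (x,α) (y,β)`** for antisymmetric `A` —
the physical first-order Hessian is (colour matrix) × (an2's antisymmetrised colourless table). [folklore] -/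
theorem symPart_wilsonVertex₁_apply (e : D → Λ) (z : Λ) (γ : D) {A : Matrix C C ℝ} (hA : Aᵀ = -A) (x y : Λ) (a b : C) (α β : D) :
    symPart (wilsonVertex₁ e z γ A) (x, (a, α)) (y, (b, β)) = A a b * wilsonStencilA e z γ (x, α) (y, β) := by
  rw [symPart_wilsonVertex₁ e z γ hA, wilsonStencilA, stencilIns_apply, stencilIns_apply, Finset.mul_sum]
  refine Finset.sum_congr rfl fun s _ => ?_
  simp only [Matrix.kronecker_apply, mul_ite, mul_zero]

/-- `adM τ t Y` is antisymmetric as a matrix (`PlaquetteVertex.adM_antisymm`). [folklore] -/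
theorem adM_transpose {𝔸 : Type*} [Ring 𝔸] [Algebra ℝ 𝔸] (τ : 𝔸 →ₗ[ℝ] ℝ) (t : C → 𝔸) (Y : 𝔸) : (adM τ t Y)ᵀ = -adM τ t Y := by
  ext a b
  rw [Matrix.transpose_apply, Matrix.neg_apply, adM_antisymm]

end SymVertex

section Headline

variable {𝔸 : Type*} [NormedRing 𝔸] [NormedAlgebra ℝ 𝔸]
variable {Λ : Type*} [Fintype Λ] [DecidableEq Λ] [AddCommGroup Λ] {C : Type*} [Fintype C] [DecidableEq C]
  {D : Type*} [Fintype D] [DecidableEq D]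

omit [DecidableEq C] in
/-- **THE HEADLINE FORM READ ON THE SYMMETRISED VERTEX**: `−½·actionJet21 (field t v) (e_z ⊗ e_γ ⊗ Y) = ½ · v ⬝ᵥ symPart (wilsonVertex₁ e z γ
(adM τ t Y)) *ᵥ v` (τ tracial) — `PlaquetteStencil.actionJet21_eq_wilsonVertex₁` with the matrix of the form replaced by the Hessian proper.
[folklore] -/
theorem actionJet21_eq_symPart (τ : 𝔸 →ₗ[ℝ] ℝ) (hτ : ∀ a b : 𝔸, τ (a * b) = τ (b * a)) (t : C → 𝔸) (e : D → Λ)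
    (v : Λ × (C × D) → ℝ) (z : Λ) (γ : D) (Y : 𝔸) :
    -((2 : ℝ)⁻¹ * jet21 ℝ τ e (field t v) (bondLetter z γ Y)) = (2 : ℝ)⁻¹ * (v ⬝ᵥ (symPart (wilsonVertex₁ e z γ (adM τ t Y)) *ᵥ v)) := by
  rw [actionJet21_eq_wilsonVertex₁ τ hτ, dotProduct_symPart_mulVec]

end Headline

/-! ## §4 Colour-blind contractions of the symmetrised vertex -/

section Contract

variable {Λ : Type*} [Fintype Λ] [DecidableEq Λ] [AddCommGroup Λ] {C : Type*} [Fintype C] [DecidableEq C]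
  {D : Type*} [Fintype D] [DecidableEq D]

/-- **THE COLOUR-BLIND BUBBLE OF THE SYMMETRISED WILSON VERTICES FACTORISES** (antisymmetric colour matrices, ANY legs):
`trace (Kcb G · symPart V(z,γ;A) · (Kcb G′ · symPart V(z+w,γ′;A′))) = trace (A·A′) · trace (K₀ · W_A(z,γ) · (K₀′ · W_A(z+w,γ′)))`. [folklore] -/
theorem wilsonBubbleSym_colourBlind (G G' : Λ → Matrix D D ℝ) (e : D → Λ) (z w : Λ) (γ γ' : D) {A A' : Matrix C C ℝ} (hA : Aᵀ = -A)
    (hA' : A'ᵀ = -A') :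
    Matrix.trace (mconvKernel (cbLeg G) * symPart (wilsonVertex₁ e z γ A) *
        (mconvKernel (cbLeg G') * symPart (wilsonVertex₁ e (z + w) γ' A'))) =
      Matrix.trace (A * A') *
        Matrix.trace (mconvKernel G * wilsonStencilA e z γ * (mconvKernel G' * wilsonStencilA e (z + w) γ')) := by
  rw [symPart_wilsonVertex₁ e z γ hA, symPart_wilsonVertex₁ e (z + w) γ' hA', wilsonStencilA, wilsonStencilA, bubble_stencil_eq_table_m,
    bubble_stencil_eq_table_m, Finset.mul_sum]
  refine Finset.sum_congr rfl fun p _ => ?_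
  rw [cbLeg_eq_kronecker, cbLeg_eq_kronecker, trace_kronLeg_mul_kronLeg_mul]

/-- … AS A FINITE TABLE over the pairs of points of the antisymmetrised stencils. [folklore] -/
theorem wilsonBubbleSym_colourBlind_table (G G' : Λ → Matrix D D ℝ) (e : D → Λ) (z w : Λ) (γ γ' : D) {A A' : Matrix C C ℝ}
    (hA : Aᵀ = -A) (hA' : A'ᵀ = -A') :
    Matrix.trace (mconvKernel (cbLeg G) * symPart (wilsonVertex₁ e z γ A) *
        (mconvKernel (cbLeg G') * symPart (wilsonVertex₁ e (z + w) γ' A'))) =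
      Matrix.trace (A * A') * ∑ p : (WilsonIdx D ⊕ WilsonIdx D) × (WilsonIdx D ⊕ WilsonIdx D),
        Matrix.trace (G (wαA e γ p.1 - wβA e γ' p.2 - w) * wnA γ p.1 * (G' (w + wαA e γ' p.2 - wβA e γ p.1) * wnA γ' p.2)) := by
  rw [wilsonBubbleSym_colourBlind G G' e z w γ γ' hA hA', wilsonStencilA, wilsonStencilA, bubble_stencil_eq_table_m,
    Finset.univ_product_univ]

omit [Fintype C] [DecidableEq C] in
/-- the antisymmetrised colourless bubble does not see the base point. [folklore] -/
theorem wilsonBubbleA_translate (G G' : Λ → Matrix D D ℝ) (e : D → Λ) (z₁ z₂ w : Λ) (γ γ' : D) :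
    Matrix.trace (mconvKernel G * wilsonStencilA e z₁ γ * (mconvKernel G' * wilsonStencilA e (z₁ + w) γ')) =
      Matrix.trace (mconvKernel G * wilsonStencilA e z₂ γ * (mconvKernel G' * wilsonStencilA e (z₂ + w) γ')) := by
  simp only [wilsonStencilA, bubble_stencil_eq_table_m]

/-- **IN BAŁABAN'S LETTERS** (complete tr-orthonormal Hermitian family, `N ≠ 0`): the colour-blind bubble of the SYMMETRISED Wilson vertices at
the background letters `gen τ c`, `gen τ c′` is `[c = c′]·(−2N²)` times the antisymmetrised colourless bubble (`adM_gen`, `trace_adMat_gen`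
BY NAME). [folklore] -/
theorem wilsonBubbleSym_gen {N : ℕ} {τ : C → Matrix (Fin N) (Fin N) ℂ} (hτ : Complete τ) (ho : TrOrthonormal τ)
    (hH : ∀ c, (τ c).IsHermitian) (hN : N ≠ 0) (G G' : Λ → Matrix D D ℝ) (e : D → Λ) (z w : Λ) (γ γ' : D) (c c' : C) :
    Matrix.trace (mconvKernel (cbLeg G) * symPart (wilsonVertex₁ e z γ (adM rntr (gen τ) (gen τ c))) *
        (mconvKernel (cbLeg G') * symPart (wilsonVertex₁ e (z + w) γ' (adM rntr (gen τ) (gen τ c'))))) =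
      (if c = c' then -(2 * (N : ℝ) ^ 2) else 0) *
        Matrix.trace (mconvKernel G * wilsonStencilA e z γ * (mconvKernel G' * wilsonStencilA e (z + w) γ')) := by
  rw [wilsonBubbleSym_colourBlind G G' e z w γ γ' (adM_transpose _ _ _) (adM_transpose _ _ _), adM_gen, adM_gen,
    trace_adMat_gen hτ ho hH hN]

/-- **THE COLOUR-BLIND TADPOLE OF THE SYMMETRISED VERTEX FACTORISES** (antisymmetric `A`, any legs). [folklore] -/
theorem wilsonTadpoleSym_colourBlind (G : Λ → Matrix D D ℝ) (e : D → Λ) (z : Λ) (γ : D) {A : Matrix C C ℝ} (hA : Aᵀ = -A) :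
    Matrix.trace (mconvKernel (cbLeg G) * symPart (wilsonVertex₁ e z γ A)) =
      Matrix.trace A * Matrix.trace (mconvKernel G * wilsonStencilA e z γ) := by
  rw [symPart_wilsonVertex₁ e z γ hA, wilsonStencilA, contact_stencil_m, contact_stencil_m, Finset.mul_sum]
  refine Finset.sum_congr rfl fun s _ => ?_
  rw [cbLeg_eq_kronecker, trace_kronLeg_mul]

/-- **… AND VANISHES**: an antisymmetric colour matrix is traceless. [folklore] -/
theorem wilsonTadpoleSym_eq_zero (G : Λ → Matrix D D ℝ) (e : D → Λ) (z : Λ) (γ : D) {A : Matrix C C ℝ} (hA : Aᵀ = -A) :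
    Matrix.trace (mconvKernel (cbLeg G) * symPart (wilsonVertex₁ e z γ A)) = 0 := by
  have h : Matrix.trace A = 0 :=
    trace_eq_zero_of_antisymm fun a b => by
      have := congrFun (congrFun hA a) b
      rwa [Matrix.transpose_apply, Matrix.neg_apply] at this
  rw [wilsonTadpoleSym_colourBlind G e z γ hA, h, zero_mul]

end Contract

/-! ## §5 Examples -/

section Examples

variable {ι : Type*} [Fintype ι]

/-- the symmetric part of an antisymmetric matrix vanishes. [folklore] -/
example {M : Matrix ι ι ℝ} (hM : Mᵀ = -M) : symPart M = 0 := by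
  rw [symPart, hM, add_neg_cancel, smul_zero]

/-- a symmetric kernel against an antisymmetric matrix gives zero. [folklore] -/
example {K M : Matrix ι ι ℝ} (hK : Kᵀ = K) (hM : Mᵀ = -M) : Matrix.trace (K * M) = 0 := by
  have h := trace_mul_transpose_of_symm hK M
  rw [hM, Matrix.mul_neg, Matrix.trace_neg] at h
  linarith

end Examples

end Literature.MathematicalPhysics.QuantumFieldTheory.Balaban1983to89.Beta.WilsonVertexSym
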